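import Summits.Ventures.PercRepro.C041TriDomExcessWeighted

/-!
# ROW C-041 — THE SYMMETRIC EXCESS AT EVERY EDGE PROBABILITY, II: complementation, the uniform case and the
statement in probabilities
(p6, gen 42; P6-TWOEXIT-LEAN.md §53 ADDENDUM 6)

On `C041TriDomExcessWeighted` (`esymP_nonneg_of_half_le`: the weighted symmetric excess of the host with every edge
free is non-negative for all edge probabilities `w e ∈ [½, 1]`).  The complementation `ZoneData.cpl` exchanges the
red and the blue pattern (`rsig_free_cpl`, `bsig_free_cpl`) and sends the weight at `w` to the weight at `1 − w`
(`cwt_cpl`), so the weighted symmetric excess at `w` equals the one at `1 − w` (`esymP_cpl`, with `Fsym` symmetric):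
**THEOREM (THE SYMMETRIC EXCESS AT EVERY EDGE PROBABILITY ≤ ½)** `esymP_nonneg_of_le_half` and the uniform case
`p ∈ [0, 1]` (`esymP_nonneg_uniform`).  In probabilities (`probPat w s t` = the probability that the red pattern is `s`
and the blue one `t`; `Fsym` is `+1` on `(⊤,⊥)`, `(⊥,⊤)` and `−1` on the six crossed pairs of two-block patterns,
`Fsym_eq_ind`):
  `P(s₁,s₂) + P(s₂,s₁) + P(s₁,s₃) + P(s₃,s₁) + P(s₂,s₃) + P(s₃,s₂) ≤ P(⊤,⊥) + P(⊥,⊤)`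
for all `p_e ∈ [½, 1]` (`probPat_crossed_le_of_half_le`), all `p_e ∈ [0, ½]` (`probPat_crossed_le_of_le_half`) and
every uniform `p ∈ [0, 1]` (`probPat_crossed_le_uniform`) — here `⊤ = (true, true, true)`, `⊥ = (false, false, false)`,
`s₁ = (true, false, false)` (`a₁ ~ u`), `s₂ = (false, true, false)` (`a₁ ~ u′`), `s₃ = (false, false, true)` (`u ~ u′`).
-/

namespace PercRepro

namespace ZoneZ

namespace MultiExit

open ZoneData Finset

variable {V₁ E₁ U₁ U₂ : Type} (Z₁ : ZoneData V₁ E₁ U₁ U₂) (u u' a₁ : V₁)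

variable [Fintype E₁] [DecidableEq E₁]

omit [Fintype E₁] [DecidableEq E₁] in
/-- The complementation exchanges the patterns: the red pattern of the complement is the blue pattern. -/
theorem rsig_free_cpl (ω : E₁ → Bool) :
    rsig Z₁ u u' a₁ (fun _ => EStat.free) (ZoneData.cpl ω) = bsig Z₁ u u' a₁ (fun _ => EStat.free) ω := by
  rw [rsig_free, bsig_free, styp_cpl]
  rfl

omit [Fintype E₁] [DecidableEq E₁] in
/-- The complementation exchanges the patterns: the blue pattern of the complement is the red pattern. -/
theorem bsig_free_cpl (ω : E₁ → Bool) :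
    bsig Z₁ u u' a₁ (fun _ => EStat.free) (ZoneData.cpl ω) = rsig Z₁ u u' a₁ (fun _ => EStat.free) ω := by
  rw [rsig_free, bsig_free, styp_cpl]
  rfl

/-- `Fsym` is symmetric. -/
theorem Fsym_comm (s t : P3) : Fsym s t = Fsym t s := by
  unfold Fsym; exact add_comm _ _

/-- The weighted symmetric excess at the complementary probabilities is the same number. -/
theorem esymP_cpl (w : E₁ → ℚ) :
    ∑ ω : E₁ → Bool, cwt w ω *
        (Fsym (rsig Z₁ u u' a₁ (fun _ => EStat.free) ω) (bsig Z₁ u u' a₁ (fun _ => EStat.free) ω) : ℚ) =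
      ∑ ω : E₁ → Bool, cwt (fun e => 1 - w e) ω *
        (Fsym (rsig Z₁ u u' a₁ (fun _ => EStat.free) ω) (bsig Z₁ u u' a₁ (fun _ => EStat.free) ω) : ℚ) := by
  have hinv : Function.Involutive (ZoneData.cpl (E := E₁)) := ZoneData.cpl_cpl
  rw [← Equiv.sum_comp hinv.toPerm (fun ω => cwt w ω *
    (Fsym (rsig Z₁ u u' a₁ (fun _ => EStat.free) ω) (bsig Z₁ u u' a₁ (fun _ => EStat.free) ω) : ℚ))]
  refine Finset.sum_congr rfl fun ω _ => ?_
  simp only [Function.Involutive.coe_toPerm]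
  rw [cwt_cpl, rsig_free_cpl, bsig_free_cpl, Fsym_comm]

/-- **THEOREM (THE SYMMETRIC EXCESS AT EVERY EDGE PROBABILITY ≤ ½)**, by complementation. -/
theorem esymP_nonneg_of_le_half (w : E₁ → ℚ) (hw : ∀ e, 0 ≤ w e ∧ w e ≤ 1 / 2) :
    0 ≤ ∑ ω : E₁ → Bool, cwt w ω *
      (Fsym (rsig Z₁ u u' a₁ (fun _ => EStat.free) ω) (bsig Z₁ u u' a₁ (fun _ => EStat.free) ω) : ℚ) := by
  rw [esymP_cpl]
  exact esymP_nonneg_of_half_le Z₁ u u' a₁ (fun e => 1 - w e) fun e =>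
    ⟨by linarith [(hw e).2], by linarith [(hw e).1]⟩

/-- **THEOREM (THE SYMMETRIC EXCESS AT EVERY UNIFORM PROBABILITY)**: every edge red with the same probability
`p ∈ [0, 1]`. -/
theorem esymP_nonneg_uniform (p : ℚ) (h0 : 0 ≤ p) (h1 : p ≤ 1) :
    0 ≤ ∑ ω : E₁ → Bool, cwt (fun _ => p) ω *
      (Fsym (rsig Z₁ u u' a₁ (fun _ => EStat.free) ω) (bsig Z₁ u u' a₁ (fun _ => EStat.free) ω) : ℚ) := by
  by_cases hp : 1 / 2 ≤ p
  · exact esymP_nonneg_of_half_le Z₁ u u' a₁ _ fun _ => ⟨hp, h1⟩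
  · exact esymP_nonneg_of_le_half Z₁ u u' a₁ _ fun _ => ⟨h0, by linarith⟩

/-! ## The statement in probabilities -/

/-- The probability that the red pattern is `s` and the blue pattern is `t` under the edge probabilities `w`
(the host with every edge free). -/
noncomputable def probPat (w : E₁ → ℚ) (s t : P3) : ℚ :=
  ∑ ω : E₁ → Bool, if rsig Z₁ u u' a₁ (fun _ => EStat.free) ω = s ∧ bsig Z₁ u u' a₁ (fun _ => EStat.free) ω = t
    then cwt w ω else 0

/-- `Fsym` as a combination of indicators: `+1` on `(⊤, ⊥)` and `(⊥, ⊤)`, `−1` on the six crossed pairs of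
two-block patterns. -/
theorem Fsym_eq_ind : ∀ s t : P3, Fsym s t =
    (if s = (true, true, true) ∧ t = (false, false, false) then 1 else 0)
      + (if s = (false, false, false) ∧ t = (true, true, true) then 1 else 0)
      - (if s = (true, false, false) ∧ t = (false, true, false) then 1 else 0)
      - (if s = (false, true, false) ∧ t = (true, false, false) then 1 else 0)
      - (if s = (true, false, false) ∧ t = (false, false, true) then 1 else 0)
      - (if s = (false, false, true) ∧ t = (true, false, false) then 1 else 0)
      - (if s = (false, true, false) ∧ t = (false, false, true) then 1 else 0)
      - (if s = (false, false, true) ∧ t = (false, true, false) then 1 else 0) := by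
  decide

/-- The weighted symmetric excess in probabilities. -/
theorem sum_cwt_Fsym_eq (w : E₁ → ℚ) :
    ∑ ω : E₁ → Bool, cwt w ω *
        (Fsym (rsig Z₁ u u' a₁ (fun _ => EStat.free) ω) (bsig Z₁ u u' a₁ (fun _ => EStat.free) ω) : ℚ) =
      probPat Z₁ u u' a₁ w (true, true, true) (false, false, false)
        + probPat Z₁ u u' a₁ w (false, false, false) (true, true, true)
        - probPat Z₁ u u' a₁ w (true, false, false) (false, true, false)
        - probPat Z₁ u u' a₁ w (false, true, false) (true, false, false)
        - probPat Z₁ u u' a₁ w (true, false, false) (false, false, true)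
        - probPat Z₁ u u' a₁ w (false, false, true) (true, false, false)
        - probPat Z₁ u u' a₁ w (false, true, false) (false, false, true)
        - probPat Z₁ u u' a₁ w (false, false, true) (false, true, false) := by
  unfold probPat
  simp only [← Finset.sum_add_distrib, ← Finset.sum_sub_distrib]
  refine Finset.sum_congr rfl fun ω _ => ?_
  rw [Fsym_eq_ind]
  push_cast
  simp only [mul_add, mul_sub, mul_ite, mul_one, mul_zero]

/-- **THE EXCESS INEQUALITY AT EVERY EDGE PROBABILITY ≥ ½, IN PROBABILITIES**: the six crossed configurations of
two-block patterns have total probability at most `P(⊤, ⊥) + P(⊥, ⊤)`. -/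
theorem probPat_crossed_le_of_half_le (w : E₁ → ℚ) (hw : ∀ e, 1 / 2 ≤ w e ∧ w e ≤ 1) :
    probPat Z₁ u u' a₁ w (true, false, false) (false, true, false)
        + probPat Z₁ u u' a₁ w (false, true, false) (true, false, false)
        + probPat Z₁ u u' a₁ w (true, false, false) (false, false, true)
        + probPat Z₁ u u' a₁ w (false, false, true) (true, false, false)
        + probPat Z₁ u u' a₁ w (false, true, false) (false, false, true)
        + probPat Z₁ u u' a₁ w (false, false, true) (false, true, false) ≤
      probPat Z₁ u u' a₁ w (true, true, true) (false, false, false)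
        + probPat Z₁ u u' a₁ w (false, false, false) (true, true, true) := by
  have h := esymP_nonneg_of_half_le Z₁ u u' a₁ w hw
  rw [sum_cwt_Fsym_eq] at h
  linarith

/-- **THE EXCESS INEQUALITY AT EVERY EDGE PROBABILITY ≤ ½, IN PROBABILITIES.** -/
theorem probPat_crossed_le_of_le_half (w : E₁ → ℚ) (hw : ∀ e, 0 ≤ w e ∧ w e ≤ 1 / 2) :
    probPat Z₁ u u' a₁ w (true, false, false) (false, true, false)
        + probPat Z₁ u u' a₁ w (false, true, false) (true, false, false)
        + probPat Z₁ u u' a₁ w (true, false, false) (false, false, true)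
        + probPat Z₁ u u' a₁ w (false, false, true) (true, false, false)
        + probPat Z₁ u u' a₁ w (false, true, false) (false, false, true)
        + probPat Z₁ u u' a₁ w (false, false, true) (false, true, false) ≤
      probPat Z₁ u u' a₁ w (true, true, true) (false, false, false)
        + probPat Z₁ u u' a₁ w (false, false, false) (true, true, true) := by
  have h := esymP_nonneg_of_le_half Z₁ u u' a₁ w hw
  rw [sum_cwt_Fsym_eq] at h
  linarith

/-- **THE EXCESS INEQUALITY AT EVERY UNIFORM EDGE PROBABILITY `p ∈ [0, 1]`, IN PROBABILITIES.** -/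
theorem probPat_crossed_le_uniform (p : ℚ) (h0 : 0 ≤ p) (h1 : p ≤ 1) :
    probPat Z₁ u u' a₁ (fun _ => p) (true, false, false) (false, true, false)
        + probPat Z₁ u u' a₁ (fun _ => p) (false, true, false) (true, false, false)
        + probPat Z₁ u u' a₁ (fun _ => p) (true, false, false) (false, false, true)
        + probPat Z₁ u u' a₁ (fun _ => p) (false, false, true) (true, false, false)
        + probPat Z₁ u u' a₁ (fun _ => p) (false, true, false) (false, false, true)
        + probPat Z₁ u u' a₁ (fun _ => p) (false, false, true) (false, true, false) ≤
      probPat Z₁ u u' a₁ (fun _ => p) (true, true, true) (false, false, false)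
        + probPat Z₁ u u' a₁ (fun _ => p) (false, false, false) (true, true, true) := by
  have h := esymP_nonneg_uniform Z₁ u u' a₁ p h0 h1
  rw [sum_cwt_Fsym_eq] at h
  linarith

end MultiExit

end ZoneZ

end PercRepro
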